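import Summits.CriticalPhenomena.SAWScalingLimit.Theorems.SAWDefectDecoherencePolygonParitySqueezeDefs
import HarnessLib

/-!
# Crux `BoundaryClosureR` (stmt-CriticalPhenomena-14004), line `polygon-parity-squeeze`,
# stub `stub_squeeze`: the CONTINUUM side of the squeeze — gate densities of inner domains

Landing target:
`Summits/CriticalPhenomena/SAWScalingLimit/Theorems/SAWDefectDecoherenceBoundaryClosureRSqueezeGateStability.lean`
(`--supports stmt-CriticalPhenomena-14004`).

The limit step of the squeeze (B) compares the conformal gate density
`x ↦ exp((5/8)(L̄(x) − L_b)) = (Φ'(x)/Φ'(b))^{5/8}` of the datum `D` with that of an inner domain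
`P ⊆ D` sharing the two marked points and the two flat pieces.  The classical input is the
CARATHÉODORY KERNEL THEOREM ON THE SHARED FLAT GATE (kernel convergence `P_n → D` plus Schwarz
reflection across the gate give convergence of the normalised derivatives on the gate); it is NOT
proved here but consumed as an explicit hypothesis in its natural SEQUENTIAL form
(`P_n ⊆ D` exhausting the compacts of `D` ⟹ some frames of the `P_n` have gate densities converging
uniformly on the gate segment of radius `ρ/4`).  This file turns that sequential statement into the
`ε`–`η` form the squeeze uses (`gateStability_eps`: for every `ε > 0` there is `η > 0` such that EVERY
inner domain containing the `η`-interior of `D` has a frame whose gate density is `ε`-close), by the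
usual contradiction-and-subsequence argument (compacts of `D` lie in some `η`-interior,
`IsCompact.exists_cthickening_subset_open`), and records the elementary integral estimates of the
limit step on the gate interval (`norm_gateIntegral_sub_le`, `norm_gateIntegral_le`,
`continuousOn_gateDensity`, `integrableOn_gate`).

Sources: Ch. Pommerenke, *Boundary Behaviour of Conformal Maps* (1992), Thm. 1.8 (kernel theorem);
H. Duminil-Copin, S. Smirnov, Ann. of Math. 175 (2012), Conjecture 2.  Everything here is proved;
no definition, no named fact (the kernel theorem enters only as a hypothesis).
-/

noncomputable section

open scoped BigOperators Topology
open Filter Set MeasureTheory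
open Literature.Probability.RandomPlanarGeometry

namespace Summit.CriticalPhenomena.SAWScalingLimit.Theorems.PolygonParitySqueeze

/-! ### 1. Compacts of an open set lie in some `η`-interior -/

/-- A compact subset of an open proper subset `Ω ⊊ ℂ` lies in the `η`-interior
`{z ∈ Ω | η ≤ infDist z Ωᶜ}` for some `η > 0`. [folklore] -/
theorem exists_subset_etaInterior {Ω K : Set ℂ} (hΩ : IsOpen Ω) (hΩne : Ωᶜ.Nonempty)
    (hK : IsCompact K) (hKΩ : K ⊆ Ω) :
    ∃ η : ℝ, 0 < η ∧ K ⊆ {z : ℂ | z ∈ Ω ∧ η ≤ Metric.infDist z Ωᶜ} := by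
  obtain ⟨η, hη, hthick⟩ := hK.exists_cthickening_subset_open hΩ hKΩ
  refine ⟨η, hη, fun z hz => ⟨hKΩ hz, ?_⟩⟩
  rw [Metric.le_infDist hΩne]
  intro y hy
  by_contra h
  have hy' : y ∈ Metric.thickening η K := Metric.mem_thickening_iff.2 ⟨z, hz, by
    rw [dist_comm]; exact not_le.1 h⟩
  exact hy (hthick (Metric.thickening_subset_cthickening η K hy'))

/-- The `η`-interiors are antitone in `η`. [folklore] -/
theorem etaInterior_anti {Ω : Set ℂ} {η η' : ℝ} (h : η ≤ η') :
    {z : ℂ | z ∈ Ω ∧ η' ≤ Metric.infDist z Ωᶜ} ⊆ {z : ℂ | z ∈ Ω ∧ η ≤ Metric.infDist z Ωᶜ} :=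
  fun _ hz => ⟨hz.1, h.trans hz.2⟩

/-! ### 2. From the sequential kernel statement to the `ε`–`η` form -/

/-- **Gate stability, `ε`–`η` form.**  Fix a Dobrushin datum `D`, a radius `ρ`, a root radius `r'`,
a conformal frame `(Φ, L, L_b)` with continuous extension `L̄` to the gate, and call a Dobrushin
domain `P` INNER if it has the same marked points, lies in `Ω`, and is flat on `B(pt 1, ρ/2)` and on
`B(pt 0, r')`.  Assume the sequential kernel statement: for every sequence of inner domains
exhausting the compacts of `Ω` there are frames `(Φ_n, L_n, L_{b,n}, L̄_n)` whose gate densities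
`exp((5/8)(L̄_n − L_{b,n}))` converge to `exp((5/8)(L̄ − L_b))` uniformly on the gate segment of
radius `ρ/4`.  Then for every `ε > 0` there is `η > 0` such that every inner domain containing the
`η`-interior of `Ω` admits a frame whose gate density is within `ε` on that segment.
[cite: PommerenkeBBCM1992, Thm. 1.8 (Carathéodory kernel theorem)] -/
theorem gateStability_eps {D : DobrushinDomain} {ρ r' : ℝ}
    {Lbar : ℂ → ℂ} {Lb : ℂ}
    (hseq : ∀ (P : ℕ → DobrushinDomain),
      (∀ n : ℕ, (P n).pt 0 = D.pt 0 ∧ (P n).pt 1 = D.pt 1 ∧ (P n).carrier ⊆ D.carrier ∧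
        (P n).carrier ∩ Metric.ball (D.pt 1) (ρ / 2) =
          {z : ℂ | (D.pt 1).im < z.im} ∩ Metric.ball (D.pt 1) (ρ / 2) ∧
        (P n).carrier ∩ Metric.ball (D.pt 0) r' =
          {z : ℂ | (D.pt 0).im < z.im} ∩ Metric.ball (D.pt 0) r') →
      (∀ K : Set ℂ, IsCompact K → K ⊆ D.carrier → ∀ᶠ n : ℕ in atTop, K ⊆ (P n).carrier) →
      ∃ (ΦP : (n : ℕ) → ConformalEquiv (P n).carrier UpperHalfPlane.upperHalfPlaneSet)
        (LP : ℕ → ℂ → ℂ) (LbP : ℕ → ℂ) (LbarP : ℕ → ℂ → ℂ),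
        (∀ n : ℕ, ConformalFrame (P n) (ΦP n) (LP n) (LbP n) ∧
          ContinuousOn (LbarP n) ((P n).carrier ∪ gateSeg (P n) (ρ / 2)) ∧
          EqOn (LbarP n) (LP n) (P n).carrier) ∧
        TendstoUniformlyOn (fun (n : ℕ) (x : ℂ) => Complex.exp ((5 / 8 : ℂ) * (LbarP n x - LbP n)))
          (fun x : ℂ => Complex.exp ((5 / 8 : ℂ) * (Lbar x - Lb))) atTop (gateSeg D (ρ / 4))) :
    ∀ ε : ℝ, 0 < ε → ∃ η : ℝ, 0 < η ∧ ∀ P : DobrushinDomain,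
      P.pt 0 = D.pt 0 → P.pt 1 = D.pt 1 → P.carrier ⊆ D.carrier →
      P.carrier ∩ Metric.ball (D.pt 1) (ρ / 2) =
        {z : ℂ | (D.pt 1).im < z.im} ∩ Metric.ball (D.pt 1) (ρ / 2) →
      P.carrier ∩ Metric.ball (D.pt 0) r' = {z : ℂ | (D.pt 0).im < z.im} ∩ Metric.ball (D.pt 0) r' →
      {z : ℂ | z ∈ D.carrier ∧ η ≤ Metric.infDist z D.carrierᶜ} ⊆ P.carrier →
      ∃ (ΦP : ConformalEquiv P.carrier UpperHalfPlane.upperHalfPlaneSet) (LP : ℂ → ℂ) (LbP : ℂ)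
        (LbarP : ℂ → ℂ), ConformalFrame P ΦP LP LbP ∧
        ContinuousOn LbarP (P.carrier ∪ gateSeg P (ρ / 2)) ∧ EqOn LbarP LP P.carrier ∧
        ∀ x ∈ gateSeg D (ρ / 4),
          ‖Complex.exp ((5 / 8 : ℂ) * (LbarP x - LbP)) - Complex.exp ((5 / 8 : ℂ) * (Lbar x - Lb))‖ ≤ ε := by
  by_contra hcon
  push Not at hcon
  obtain ⟨ε, hε, hbad⟩ := hcon
  -- a violating inner domain for every `η = 1/(n+1)`
  choose P hP using fun n : ℕ => hbad (1 / ((n : ℝ) + 1)) (by positivity)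
  have hinner : ∀ n : ℕ, (P n).pt 0 = D.pt 0 ∧ (P n).pt 1 = D.pt 1 ∧ (P n).carrier ⊆ D.carrier ∧
      (P n).carrier ∩ Metric.ball (D.pt 1) (ρ / 2) =
        {z : ℂ | (D.pt 1).im < z.im} ∩ Metric.ball (D.pt 1) (ρ / 2) ∧
      (P n).carrier ∩ Metric.ball (D.pt 0) r' =
        {z : ℂ | (D.pt 0).im < z.im} ∩ Metric.ball (D.pt 0) r' := fun n =>
    ⟨(hP n).1, (hP n).2.1, (hP n).2.2.1, (hP n).2.2.2.1, (hP n).2.2.2.2.1⟩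
  -- the compacts of `Ω` are eventually inside
  have hK1 : ∀ K : Set ℂ, IsCompact K → K ⊆ D.carrier → ∀ᶠ n : ℕ in atTop, K ⊆ (P n).carrier := by
    intro K hK hKD
    obtain ⟨η, hη, hKη⟩ := exists_subset_etaInterior D.isOpen
      (Set.nonempty_compl.2 D.carrier_ne_univ) hK hKD
    have hev : ∀ᶠ n : ℕ in atTop, 1 / ((n : ℝ) + 1) < η :=
      (tendsto_one_div_add_atTop_nhds_zero_nat.eventually (gt_mem_nhds hη))
    filter_upwards [hev] with n hn
    exact (hKη.trans (etaInterior_anti hn.le)).trans (hP n).2.2.2.2.2.1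
  obtain ⟨ΦP, LP, LbP, LbarP, hframe, hunif⟩ := hseq P hinner hK1
  have hev := (Metric.tendstoUniformlyOn_iff.1 hunif) ε hε
  obtain ⟨n, hn⟩ := hev.exists
  obtain ⟨x, hx, hlt⟩ := (hP n).2.2.2.2.2.2 (ΦP n) (LP n) (LbP n) (LbarP n) (hframe n).1
    (hframe n).2.1 (hframe n).2.2
  have := hn x hx
  rw [dist_comm, dist_eq_norm] at this
  linarith

/-! ### 3. Integral estimates on the gate interval -/

/-- Points of the gate line: `dist (x + i·im c) c = |x - re c|`. [folklore] -/
theorem dist_gatePoint (c : ℂ) (x : ℝ) :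
    dist ((x : ℂ) + (c.im : ℂ) * Complex.I) c = |x - c.re| := by
  rw [Complex.dist_eq]
  have : (x : ℂ) + (c.im : ℂ) * Complex.I - c = ((x - c.re : ℝ) : ℂ) := by
    apply Complex.ext <;> simp
  rw [this, Complex.norm_real, Real.norm_eq_abs]

/-- Points `x + i·im c` with `|x - re c| < r` lie on the gate segment `gateSeg D r` (`c = pt 1`).
[folklore] -/
theorem gatePoint_mem_gateSeg (D : DobrushinDomain) {r x : ℝ} (hx : |x - (D.pt 1).re| < r) :
    ((x : ℂ) + ((D.pt 1).im : ℂ) * Complex.I) ∈ gateSeg D r := by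
  refine ⟨by simp, ?_⟩
  rw [Metric.mem_ball, dist_gatePoint]
  exact hx

/-- **The gate density is continuous on the gate interval.** If `L̄` is continuous on
`Ω ∪ gateSeg D ρ` and `r < ρ`, then `x ↦ exp((5/8)(L̄(x + i·im pt 1) − L_b))` is continuous on
`[re pt 1 − r, re pt 1 + r]`. [folklore] -/
theorem continuousOn_gateDensity (D : DobrushinDomain) {ρ r : ℝ} {Lbar : ℂ → ℂ} (Lb : ℂ)
    (hLbar : ContinuousOn Lbar (D.carrier ∪ gateSeg D ρ)) (hr : r < ρ) :
    ContinuousOn (fun x : ℝ => Complex.exp ((5 / 8 : ℂ) *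
        (Lbar ((x : ℂ) + ((D.pt 1).im : ℂ) * Complex.I) - Lb)))
      (Set.Icc ((D.pt 1).re - r) ((D.pt 1).re + r)) := by
  have hγ : Continuous fun x : ℝ => (x : ℂ) + ((D.pt 1).im : ℂ) * Complex.I := by fun_prop
  have hmaps : MapsTo (fun x : ℝ => (x : ℂ) + ((D.pt 1).im : ℂ) * Complex.I)
      (Set.Icc ((D.pt 1).re - r) ((D.pt 1).re + r)) (D.carrier ∪ gateSeg D ρ) := by
    intro x hx
    refine Or.inr (gatePoint_mem_gateSeg D ?_)
    rw [abs_lt]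
    constructor <;> linarith [hx.1, hx.2]
  exact (((hLbar.comp hγ.continuousOn hmaps).sub continuousOn_const).const_smul (5 / 8 : ℂ)).cexp

/-- A continuous weight times a density continuous on the closed gate interval is integrable on the
open gate interval. [folklore] -/
theorem integrableOn_gate {G d : ℝ → ℂ} {x₁ r : ℝ} (hG : Continuous G)
    (hd : ContinuousOn d (Set.Icc (x₁ - r) (x₁ + r))) :
    IntegrableOn (fun x => G x * d x) (Set.Ioo (x₁ - r) (x₁ + r)) :=
  ((hG.continuousOn.mul hd).integrableOn_Icc).mono_set Set.Ioo_subset_Icc_self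

/-- **Difference of two gate integrals**: if the integrands are integrable on the gate interval of
half-length `r ≥ 0` and differ by at most `C` pointwise, the integrals differ by at most `C · 2r`.
[folklore] -/
theorem norm_gateIntegral_sub_le {F F' : ℝ → ℂ} {x₁ r C : ℝ} (hr : 0 ≤ r)
    (hF : IntegrableOn F (Set.Ioo (x₁ - r) (x₁ + r)))
    (hF' : IntegrableOn F' (Set.Ioo (x₁ - r) (x₁ + r)))
    (hC : ∀ x ∈ Set.Ioo (x₁ - r) (x₁ + r), ‖F' x - F x‖ ≤ C) :
    ‖(∫ x in Set.Ioo (x₁ - r) (x₁ + r), F' x) - ∫ x in Set.Ioo (x₁ - r) (x₁ + r), F x‖ ≤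
      C * (2 * r) := by
  rw [← integral_sub hF' hF]
  have h := norm_setIntegral_le_of_norm_le_const (measure_Ioo_lt_top (μ := volume)) hC
  rwa [Real.volume_real_Ioo_of_le (by linarith), show x₁ + r - (x₁ - r) = 2 * r by ring] at h

/-- **Size of a gate integral**: an integrand bounded by `C` on the gate interval of half-length
`r ≥ 0` has integral of norm at most `C · 2r`. [folklore] -/
theorem norm_gateIntegral_le {F : ℝ → ℂ} {x₁ r C : ℝ} (hr : 0 ≤ r)
    (hC : ∀ x ∈ Set.Ioo (x₁ - r) (x₁ + r), ‖F x‖ ≤ C) :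
    ‖∫ x in Set.Ioo (x₁ - r) (x₁ + r), F x‖ ≤ C * (2 * r) := by
  have h := norm_setIntegral_le_of_norm_le_const (measure_Ioo_lt_top (μ := volume)) hC
  rwa [Real.volume_real_Ioo_of_le (by linarith), show x₁ + r - (x₁ - r) = 2 * r by ring] at h

/-! ### Registered form (sub-goal of `stub_squeeze`) -/

/-- **Registered sub-goal `squeeze_gateStabilityEps`** (crux item stmt-CriticalPhenomena-14004, line
`polygon-parity-squeeze`, stub `stub_squeeze`): the `ε`–`η` form of gate stability from its
sequential (Carathéodory-kernel) form, `gateStability_eps`.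
[cite: PommerenkeBBCM1992, Thm. 1.8 (Carathéodory kernel theorem)] -/
theorem squeeze_gateStabilityEps : ∀ (D : DobrushinDomain) (ρ r' : ℝ) (Lbar : ℂ → ℂ) (Lb : ℂ), (∀ (P : ℕ → DobrushinDomain), (∀ n : ℕ, (P n).pt 0 = D.pt 0 ∧ (P n).pt 1 = D.pt 1 ∧ (P n).carrier ⊆ D.carrier ∧ (P n).carrier ∩ Metric.ball (D.pt 1) (ρ / 2) = {z : ℂ | (D.pt 1).im < z.im} ∩ Metric.ball (D.pt 1) (ρ / 2) ∧ (P n).carrier ∩ Metric.ball (D.pt 0) r' = {z : ℂ | (D.pt 0).im < z.im} ∩ Metric.ball (D.pt 0) r') → (∀ K : Set ℂ, IsCompact K → K ⊆ D.carrier → ∀ᶠ n : ℕ in atTop, K ⊆ (P n).carrier) → ∃ (ΦP : (n : ℕ) → ConformalEquiv (P n).carrier UpperHalfPlane.upperHalfPlaneSet) (LP : ℕ → ℂ → ℂ) (LbP : ℕ → ℂ) (LbarP : ℕ → ℂ → ℂ), (∀ n : ℕ, ConformalFrame (P n) (ΦP n) (LP n) (LbP n) ∧ ContinuousOn (LbarP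 n) ((P n).carrier ∪ gateSeg (P n) (ρ / 2)) ∧ EqOn (LbarP n) (LP n) (P n).carrier) ∧ TendstoUniformlyOn (fun (n : ℕ) (x : ℂ) => Complex.exp ((5 / 8 : ℂ) * (LbarP n x - LbP n))) (fun x : ℂ => Complex.exp ((5 / 8 : ℂ) * (Lbar x - Lb))) atTop (gateSeg D (ρ / 4))) → ∀ ε : ℝ, 0 < ε → ∃ η : ℝ, 0 < η ∧ ∀ P : DobrushinDomain, P.pt 0 = D.pt 0 → P.pt 1 = D.pt 1 → P.carrier ⊆ D.carrier → P.carrier ∩ Metric.ball (D.pt 1) (ρ / 2) = {z : ℂ | (D.pt 1).im < z.im} ∩ Metric.ball (D.pt 1) (ρ / 2) → P.carrier ∩ Metric.ball (D.pt 0) r' = {z : ℂ | (D.pt 0).im < z.im} ∩ Metric.ball (D.pt 0) r' → {z : ℂ | z ∈ D.carrier ∧ η ≤ Metric.infDist z D.carrierᶜ} ⊆ P.carrier → ∃ (ΦP : ConformalEquiv P.carrier UpperHalfPlane.upperHalfPlaneSet) (LP : ℂ → ℂ) (LbP : ℂ) (LbarP : ℂ → ℂ), ConformalFrame P ΦP LP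 LbP ∧ ContinuousOn LbarP (P.carrier ∪ gateSeg P (ρ / 2)) ∧ EqOn LbarP LP P.carrier ∧ ∀ x ∈ gateSeg D (ρ / 4), ‖Complex.exp ((5 / 8 : ℂ) * (LbarP x - LbP)) - Complex.exp ((5 / 8 : ℂ) * (Lbar x - Lb))‖ ≤ ε :=
  fun _ _ _ _ _ hseq => gateStability_eps hseq

end Summit.CriticalPhenomena.SAWScalingLimit.Theorems.PolygonParitySqueeze

end
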